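import Literature.NumberTheory.Sieve.LargestPrimeFactorCubicRootPairs
import Literature.NumberTheory.Sieve.PolynomialCongruencesRootCount
import Literature.NumberTheory.Sieve.HeathBrownCubicPrimes
import HarnessLib

/-!
# Heath-Brown 2001 (PLMS), §§4, 6, 7: `ρ(e) = #{j (mod e) : j³ ≡ 2}` — prime values `g(p)`,
# Hensel at `p ≥ 5`, multiplicativity

Topic `Literature/NumberTheory/Sieve`; a PROVED arithmetic layer (no named facts) under the named fact
`Irving2015_largestPrimeFactor_cubic` (`LargestPrimeFactorCubic.lean`), continuing `…RootPairs`
(`rootsCube e`, `card_rootsCube = ρ_{X³−2}(e)`).  Source: D. R. Heath-Brown, *The largest prime factor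
of `X³ + 2`*, Proc. London Math. Soc. (3) 82 (2001) 554–596: `g(p) = #{P : N(P) = p}` (p. 22) is, for
`p ≥ 5`, the number of cube roots of `2` modulo `p` (Dedekind; the tree's `cubeRootTwoCount`); the
main term of §4/§6 carries `g_q(d) = ∏_{p∣d} g(p)` for square-free `d` ("the multiplicative function
defined by taking …", p. 22), and Lemma 7 (p. 29) uses `ν(r) = ∑_{N(R)=r} γ(R)ρ(R)`, i.e. in root
language `ρ(p^e) = g(p)` for `p ≥ 5`, `e ≥ 1` (Hensel: a root `k` of `x³ − 2 (mod p)`, `p ∤ 6`, has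
`3k² ≢ 0`).

PROVED here: `card_rootsCube_prime` (`#rootsCube p = g(p)`), `card_rootsCube_two/three` (`= 1`),
`card_rootsCube_prime_pow` (`#rootsCube (p^a) = g(p)`, `p ≥ 5`, `a ≥ 1`),
`card_rootsCube_mul` (multiplicativity), `card_rootsCube_squarefree`
(`#rootsCube d = ∏_{p∣d} #rootsCube p` for square-free `d`).

## References

* D. R. Heath-Brown, *The largest prime factor of `X³ + 2`*, Proc. London Math. Soc. (3) 82 (2001)
  554–596, §6 p. 22 (`g`, `g_q`), §7 p. 29 (`ν(r)`). [`HeathBrown2001LargestPrimeFactorCubic`]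

## Mathlib / tree search

Tree: `rootsCube`, `card_rootsCube`, `cubicF` (`…RootPairs`); `polyRootCountMod_mul_of_coprime`,
`polyRootCountMod_eq_prod_primeFactors`, `polyRootCountMod_prime_pow_eq` (Hensel),
`CubicPrimes.cubeRootTwoCount`.  Mathlib: `Nat.ModEq`, `Int.natCast_dvd_natCast`, `ZMod`.
-/

noncomputable section

open Finset Polynomial

namespace Literature.NumberTheory.Sieve.HeathBrown2001

open CubicPrimes (cubeRootTwoCount)

/-! ### Prime moduli -/

/-- `#rootsCube p = g(p) = cubeRootTwoCount p` (the same finite set, `ℤ`- vs `ℕ`-congruence).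
[cite: HeathBrown2001LargestPrimeFactorCubic, §6 p. 22 (g(p))] -/
theorem card_rootsCube_eq_cubeRootTwoCount (p : ℕ) : #(rootsCube p) = cubeRootTwoCount p := by
  unfold rootsCube cubeRootTwoCount
  congr 1
  ext k
  simp only [mem_filter, mem_range, and_congr_right_iff]
  intro _
  rw [Nat.ModEq.comm, Nat.modEq_iff_dvd]
  push_cast
  exact Iff.rfl

/-- `#rootsCube 1 = 1`, `#rootsCube 2 = 1`, `#rootsCube 3 = 1`. [folklore] -/
theorem card_rootsCube_small : #(rootsCube 1) = 1 ∧ #(rootsCube 2) = 1 ∧ #(rootsCube 3) = 1 := by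
  refine ⟨by decide, ?_, ?_⟩
  · rw [card_rootsCube_eq_cubeRootTwoCount, CubicPrimes.cubeRootTwoCount_two]
  · rw [card_rootsCube_eq_cubeRootTwoCount, CubicPrimes.cubeRootTwoCount_three]

/-! ### Prime powers `p ≥ 5`: Hensel -/

/-- For a prime `p ≥ 5`, no root of `x³ − 2 (mod p)` is a root of the derivative `3x²`. [folklore] -/
theorem cubicF_separable_mod {p : ℕ} (hp : p.Prime) (h5 : 5 ≤ p) (μ : ℤ)
    (hμ : (p : ℤ) ∣ cubicF.eval μ) : ¬ (p : ℤ) ∣ cubicF.derivative.eval μ := by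
  have hp' : Prime (p : ℤ) := Nat.prime_iff_prime_int.mp hp
  simp only [cubicF, eval_sub, eval_pow, eval_X, eval_C] at hμ
  have hder : cubicF.derivative.eval μ = 3 * μ ^ 2 := by
    simp [cubicF]
  rw [hder]
  intro h3
  rcases hp'.dvd_or_dvd h3 with h | h
  · have : (p : ℤ) ≤ 3 := Int.le_of_dvd (by norm_num) h
    have : (5 : ℤ) ≤ p := by exact_mod_cast h5
    omega
  · have hμp : (p : ℤ) ∣ μ := hp'.dvd_of_dvd_pow h
    have : (p : ℤ) ∣ 2 := by
      have := dvd_sub (dvd_pow hμp three_ne_zero) hμ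
      rwa [show μ ^ 3 - (μ ^ 3 - 2) = 2 by ring] at this
    have : (p : ℤ) ≤ 2 := Int.le_of_dvd (by norm_num) this
    have : (5 : ℤ) ≤ p := by exact_mod_cast h5
    omega

/-- **`#rootsCube (p^a) = g(p)`** for a prime `p ≥ 5` and `a ≥ 1` (Hensel).
[cite: HeathBrown2001LargestPrimeFactorCubic, §7 p. 29 (ν(r) = Σ γ(R)ρ(R))] -/
theorem card_rootsCube_prime_pow {p : ℕ} (hp : p.Prime) (h5 : 5 ≤ p) {a : ℕ} (ha : 1 ≤ a) :
    #(rootsCube (p ^ a)) = cubeRootTwoCount p := by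
  rw [card_rootsCube, polyRootCountMod_prime_pow_eq hp (cubicF_separable_mod hp h5) ha, ← card_rootsCube,
    card_rootsCube_eq_cubeRootTwoCount]

/-! ### Multiplicativity -/

/-- `#rootsCube (mn) = #rootsCube m · #rootsCube n` for coprime `m, n` (Chinese remainder theorem).
[folklore] -/
theorem card_rootsCube_mul {m n : ℕ} (h : m.Coprime n) :
    #(rootsCube (m * n)) = #(rootsCube m) * #(rootsCube n) := by
  rw [card_rootsCube, card_rootsCube, card_rootsCube, polyRootCountMod_mul_of_coprime _ h]

/-- **`#rootsCube d = ∏_{p ∣ d} #rootsCube p`** for square-free `d` ("the multiplicative function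
`g_q(d)`", p. 22). [cite: HeathBrown2001LargestPrimeFactorCubic, §6 p. 22] -/
theorem card_rootsCube_squarefree {d : ℕ} (hd : Squarefree d) :
    #(rootsCube d) = ∏ p ∈ d.primeFactors, #(rootsCube p) := by
  rw [card_rootsCube, polyRootCountMod_eq_prod_primeFactors _ hd.ne_zero]
  refine prod_congr rfl fun p hp => ?_
  have hpP := Nat.prime_of_mem_primeFactors hp
  have hfac : d.factorization p = 1 :=
    le_antisymm (hd.natFactorization_le_one p) (hpP.factorization_pos_of_dvd hd.ne_zero (Nat.dvd_of_mem_primeFactors hp))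
  rw [hfac, pow_one, card_rootsCube]

/-- Hence for square-free `d`: `#rootsCube d = ∏_{p ∣ d} g(p)`. [cite: HeathBrown2001LargestPrimeFactorCubic, §6 p. 22] -/
theorem card_rootsCube_squarefree_eq_prod_g {d : ℕ} (hd : Squarefree d) :
    #(rootsCube d) = ∏ p ∈ d.primeFactors, cubeRootTwoCount p := by
  rw [card_rootsCube_squarefree hd]
  exact prod_congr rfl fun p _ => card_rootsCube_eq_cubeRootTwoCount p

/-- `#rootsCube p ≤ 3` at primes (a cubic has at most three roots modulo `p`).
[folklore] -/
theorem card_rootsCube_prime_le {p : ℕ} (hp : p.Prime) : #(rootsCube p) ≤ 3 := by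
  rw [card_rootsCube_eq_cubeRootTwoCount]
  exact CubicPrimes.cubeRootTwoCount_le_three hp

end Literature.NumberTheory.Sieve.HeathBrown2001
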